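import Summits.HodgeConjecture.HodgeConjecture.Theorems.F0P3TranslateDetection   -- ★ B5a (F0P3-p02 (g3)): `exists_gkMap_ne_zero_of_closedSubrep`
import Literature.NumberTheory.Automorphic.DiscreteAutomorphicRepArchIsotypy       -- ★ p797762 (F0-typ3): letter F1a `DiscreteAutomorphicRep.ArchIsotypy`
import Literature.NumberTheory.Automorphic.GKSubquotient                           -- ★ `GKSubmodule.subLie`, `GKSubmodule.isGKModule_sub`
import HarnessLib

/-!
# Crux `H413` — RUNG 1½ «ISOTYPY FROM A NULL CORE», brick B5b: ARCHIMEDEAN ISOTYPY (letter F1a BY NAME) FROM ONE CLOSED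
# `G`-INVARIANT SUBSPACE WITH AN IRREDUCIBLE ADMISSIBLE HARISH-CHANDRA CORE

Floor-0 programme P3 «U3-mult», seat F0P3-p01 (g4); crux item stmt-HodgeConjecture-24833 (`HCCMUnconditional.H413`); rung-1 line
`Cruxes/H413/Lines/F0_U3LettersRung1.lean` ed. 2, stub `stub_F1a_cm : StubF1aCM` (letter F1a ★ `DiscreteAutomorphicRep.ArchIsotypy` at the CM
frame); road «F1a in-house at the pin» (F0P3-p02 (g3), `F0/P3/F0P3-p02/ROAD-F1a-inhouse.F0P3p02g3.md`: B1 ★ `F0P3GenIrreducibleOfUnitary`, B2 ★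
`HarishChandraModuleIntertwiners`, B3 ★ `F0P3LieSpanClosureInvariant` ∕ `F0P3HolFormClosedSubrep`, B4 ★ `F0P3GenClosureKFinite` ∕
`F0P3HolFormGenClasses`, B5a ★ `F0P3TranslateDetection`).  F0P3-plan (g2) GO 2026-08-31T01:50:31Z.  HC_CM is proved only modulo the printed
citations until rung 0 closes.

GENERIC setting = the standing data of the letter: a discrete automorphic `P` of `G(𝔸_K)` (a topologically IRREDUCIBLE closed invariant subspace
of `L²`), a linear real group `G` with `ιG : G →* G(𝔸_K)` continuous, its archimedean `(𝔤, K)`-module `P.archModule G ιG` (★ D4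
`DiscreteAutomorphicRepArchModule`: smooth `K`-finite vectors of `P|_G`, actions `P.archRepK`, `P.archRepLie`), and a CLOSED `P|_G`-INVARIANT
subspace `W` (`ContRepresentation.ClosedSubrep (P.archRep G ιG)`).

THE MATHEMATICS.  The *Harish-Chandra core* of `W` is `W₀ := P.archModule G ιG ⊓ W` — the smooth `K`-finite vectors of `P|_G` lying in `W` —
read as the submodule `W.comap (archModule).subtype` of the archimedean module.  It is `K`-stable (`W` is) and `𝔤`-stable (the orthogonal
projection `p_W` commutes with `P|_G`, hence with the differential, ★ B2 `map_dπ_archRep`, and is the identity on `W`), so it is a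
sub-`(𝔤, K)`-module (★ `GKSubmodule.isGKModule_sub`).  By TRANSLATE DETECTION (★ B5a: `P` irreducible and `G(𝔸_K) = ιG(G) · C` with `C`
centralising `ιG(G)` — the `hfac` hypothesis INSIDE the letter) every non-zero `v ∈ P.archModule G ιG` is mapped by a `(𝔤, K)`-endomorphism
`φ_v` of the archimedean module (the Harish-Chandra map of `p_W ∘ P(c⁻¹)`, some `c ∈ C`) to a NON-ZERO vector of `W₀`.  Consequently:

* **HEAD 1 `archIsotypy_of_gkMap_injOn_core`** — if some `(𝔤, K)`-map `ψ : P.archModule G ιG → M` into an irreducible admissible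
  `(𝔤, K)`-module `M` is injective on `W₀` (for ONE closed invariant `W ≠ ⊥`), then the maps `ψ ∘ φ_v` separate vectors: `P.ArchIsotypy G ιG`
  holds BY NAME (its `hfac` binder is consumed, not assumed outside).
* **HEAD 2 `archIsotypy_of_core`** — if `W ≠ ⊥` and the core `W₀` with its restricted actions is itself an irreducible admissible
  `(𝔤, K)`-module, then `P.ArchIsotypy G ιG` (take `M := W₀`, `ψ_v :=` the co-restriction of `φ_v`).
* **HEAD 3 `archIsotypy_of_core'`** — the same with irreducibility of `W₀` stated in SUBMODULE LANGUAGE inside the archimedean module (every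
  `(𝔤, K)`-submodule `U ≤ W₀` is `⊥` or `W₀`, and `W₀ ≠ ⊥`), the currency of ★ B1 `eq_bot_or_eq_gen_of_isGKSubmodule` — via the generic
  transport `isIrreducibleGK_sub_of_submodules` (§1).

This is the «restriction of an irreducible unitary representation to a commuting factor is isotypic» half of the tensor-product theorem in
the only form the cell consumes, obtained WITHOUT type-I theory [Dixmier1977, §13.1.8] and WITHOUT Flath's theorem [FlathCorvallis1979, Thm. 3–4]:
the one irreducible admissible module is supplied by the consumer (at the CM pin: the `(𝔤, K)`-module generated by the classes of a holomorphic
cotangent form, B1∕B4 of the road), and the separating family comes from `P.irreducible` alone (B5a).  [cite: Dixmier1977, §13.1.2 and §13.1.8]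
[cite: BorelJacquetCorvallis1979, §4.3 and §4.6] [cite: FlathCorvallis1979, Thm. 3 and Thm. 4] [cite: BorelWallach2000, 0 §2.4–2.5]
[cite: KnappVogan1995, §I.3–I.4]

USAGE NOTE.  The core's carrier `↥(W.toSubmodule.comap (P.archModule G ιG).subtype)` is a third-level subtype of `L²`; the `(𝔤, K)` predicates on
it must be written with the carrier given explicitly, `IsIrreducibleGK (V := ↥core) …`, `IsAdmissibleGK (V := ↥core) …` (as in HEADS 2–3), under
`set_option synthInstance.maxHeartbeats 100000 in`.

No definition, no `sorry`, no named fact; `--supports stmt-HodgeConjecture-24833`.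
-/

set_option autoImplicit false
-- the mandated namespace repeats `HodgeConjecture.HodgeConjecture`, as in every `Theorems/*.lean` of this sub-problem
set_option linter.dupNamespace false

-- Mathlib idiom (Mathlib/Algebra/Lie/OfAssociative.lean; as in ★ `GKModules`, ★ `HarishChandraModuleIntertwiners`): the commutator bracket on
-- `Module.End ℂ V`, needed to MENTION `G.lie →ₗ⁅ℝ⁆ Module.End ℂ _`.
attribute [local instance 100] LieRing.ofAssociativeRing

open MeasureTheory NumberField
open scoped InnerProductSpace Matrix.Norms.Operator

universe u

namespace Summit.HodgeConjecture.HodgeConjecture.Cruxes.H413.F0P3ArchIsotypyOfIrreducibleCore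

open Literature.NumberTheory.Automorphic

/-! ## §1 Generic `(𝔤, K)` algebra: the `(𝔤, K)`-submodules of a sub-`(𝔤, K)`-module, irreducibility in submodule language -/

section GKAlgebra

variable {A : Type*} [NormedCommRing A] [NormedAlgebra ℝ A] [NormedAlgebra ℚ A] [CompleteSpace A]
  [StarRing A] {N : Type*} [Fintype N] [DecidableEq N] {G : RealMatrixGroup A N}
  {V : Type*} [AddCommGroup V] [Module ℂ V]
  {ρK : Representation ℂ G.maximalCompact V} {ρ𝔤 : G.lie →ₗ⁅ℝ⁆ Module.End ℂ V} {U : Submodule ℂ V}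
  (hK : ∀ k : G.maximalCompact, U ≤ U.comap (ρK k)) (h𝔤 : ∀ X : G.lie, U ≤ U.comap (ρ𝔤 X))

/-- A `(𝔤, K)`-submodule of the sub-`(𝔤, K)`-module `U` (restricted actions ★ `Representation.subrepresentation`, ★ `GKSubmodule.subLie`),
pushed into `V` along the inclusion, is a `(𝔤, K)`-submodule of `V` (contained in `U`). [cite: KnappVogan1995, §I.3–I.4] -/
theorem isGKSubmodule_map_subtype {W : Submodule ℂ U}
    (hW : IsGKSubmodule (ρK.subrepresentation U hK) (GKSubmodule.subLie G ρ𝔤 U h𝔤) W) :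
    IsGKSubmodule ρK ρ𝔤 (W.map U.subtype) := by
  refine ⟨fun k w hw => ?_, fun X w hw => ?_⟩
  · obtain ⟨w', hw', rfl⟩ := hw
    exact ⟨ρK.subrepresentation U hK k w', hW.1 k w' hw', rfl⟩
  · obtain ⟨w', hw', rfl⟩ := hw
    exact ⟨GKSubmodule.subLie G ρ𝔤 U h𝔤 X w', hW.2 X w' hw', rfl⟩

/-- A `(𝔤, K)`-submodule of `V`, pulled back to the sub-`(𝔤, K)`-module `U` along the inclusion, is a `(𝔤, K)`-submodule of `U`.
[cite: KnappVogan1995, §I.3–I.4] -/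
theorem isGKSubmodule_comap_subtype {W : Submodule ℂ V} (hW : IsGKSubmodule ρK ρ𝔤 W) :
    IsGKSubmodule (ρK.subrepresentation U hK) (GKSubmodule.subLie G ρ𝔤 U h𝔤) (W.comap U.subtype) :=
  ⟨fun k w hw => hW.1 k (w : V) hw, fun X w hw => hW.2 X (w : V) hw⟩

/-- **Irreducibility of a sub-`(𝔤, K)`-module in submodule language.**  If `U ≠ ⊥` and every `(𝔤, K)`-submodule of `V` contained in `U` is
`⊥` or `U`, then `U` with its restricted actions is an irreducible `(𝔤, K)`-module (`IsIrreducibleGK`).  (The currency of ★ B1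
`F0P3GenIrreducibleOfUnitary.eq_bot_or_eq_gen_of_isGKSubmodule` ↦ the currency of the letter F1a.) [cite: KnappVogan1995, §II.4 (after Cor. 2.78)] -/
theorem isIrreducibleGK_sub_of_submodules (hU : U ≠ ⊥)
    (hirr : ∀ W : Submodule ℂ V, IsGKSubmodule ρK ρ𝔤 W → W ≤ U → W = ⊥ ∨ W = U) :
    IsIrreducibleGK (ρK.subrepresentation U hK) (GKSubmodule.subLie G ρ𝔤 U h𝔤) := by
  refine ⟨Submodule.nontrivial_iff_ne_bot.mpr hU, fun W hW => ?_⟩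
  rcases hirr (W.map U.subtype) (isGKSubmodule_map_subtype hK h𝔤 hW) (Submodule.map_subtype_le U W) with h | h
  · left
    exact (Submodule.map_injective_of_injective U.injective_subtype) (h.trans (Submodule.map_bot U.subtype).symm)
  · right
    exact (Submodule.map_injective_of_injective U.injective_subtype) (h.trans (Submodule.map_subtype_top U).symm)

/-- Conversely, if `U` with its restricted actions is irreducible, every `(𝔤, K)`-submodule of `V` contained in `U` is `⊥` or `U`.
[cite: KnappVogan1995, §II.4 (after Cor. 2.78)] -/
theorem eq_bot_or_eq_of_isIrreducibleGK_sub
    (hirr : IsIrreducibleGK (ρK.subrepresentation U hK) (GKSubmodule.subLie G ρ𝔤 U h𝔤))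
    {W : Submodule ℂ V} (hW : IsGKSubmodule ρK ρ𝔤 W) (hWU : W ≤ U) : W = ⊥ ∨ W = U := by
  have hWeq : (W.comap U.subtype).map U.subtype = W := by
    rw [Submodule.map_comap_subtype, inf_eq_right.mpr hWU]
  rcases hirr.eq_bot_or_eq_top (isGKSubmodule_comap_subtype hK h𝔤 hW) with h | h
  · left
    rw [← hWeq, h, Submodule.map_bot]
  · right
    rw [← hWeq, h, Submodule.map_subtype_top]

end GKAlgebra

/-! ## §2 The Harish-Chandra core `P.archModule G ιG ⊓ W` of a closed `P|_G`-invariant subspace is a sub-`(𝔤, K)`-module -/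

section Core

variable {K : Type} [Field K] [NumberField K] {𝒢 : AdelicGroupData.{u} K}
  {μ : Measure 𝒢.automorphicQuotient} [𝒢.IsAutomorphicMeasure μ]
  {A : Type*} [NormedCommRing A] [NormedAlgebra ℝ A] [NormedAlgebra ℚ A] [CompleteSpace A]
  [StarRing A] {N : Type*} [Fintype N] [DecidableEq N]
  (P : DiscreteAutomorphicRep 𝒢 μ) (G : RealMatrixGroup A N) (ιG : G.carrier →* 𝒢.Adelic)
  (W : ContRepresentation.ClosedSubrep (P.archRep G ιG))

/-- Membership in the core `W.comap (archModule).subtype`: a smooth `K`-finite vector lying in `W`. [folklore] -/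
theorem mem_core_iff (w : P.archModule G ιG) :
    w ∈ W.toSubmodule.comap (P.archModule G ιG).subtype ↔ (w : P.space.toSubmodule) ∈ W := Iff.rfl

/-- **The core is `K`-stable** (`W` is `P|_G`-invariant; ★ `coe_archRepK_apply`). [cite: BorelWallach2000, 0 §2.4] -/
theorem core_le_comap_archRepK (k : G.maximalCompact) :
    W.toSubmodule.comap (P.archModule G ιG).subtype ≤
      (W.toSubmodule.comap (P.archModule G ιG).subtype).comap (P.archRepK G ιG k) := by
  intro w hw
  change ((P.archRepK G ιG k w : P.archModule G ιG) : P.space.toSubmodule) ∈ W.toSubmodule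
  rw [P.coe_archRepK_apply]
  exact W.apply_mem _ hw

variable [FiniteDimensional ℝ A] (hι : Continuous ιG)

/-- **The core is `𝔤`-stable**: for `w` smooth `K`-finite in `W`, `dP(X) w = p_W (dP(X) w) ∈ W`, because the orthogonal projection `p_W`
commutes with `P|_G` (★ B2 `starProjection_archRep`), hence with the differential (★ B2 `map_dπ_archRep`), and fixes `w`.
[cite: BorelWallach2000, 0 §2.4–2.5] [cite: Dixmier1977, §13.1.2] -/
theorem core_le_comap_archRepLie (X : G.lie) :
    W.toSubmodule.comap (P.archModule G ιG).subtype ≤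
      (W.toSubmodule.comap (P.archModule G ιG).subtype).comap (P.archRepLie G ιG hι X) := by
  intro w hw
  change ((P.archRepLie G ιG hι X w : P.archModule G ιG) : P.space.toSubmodule) ∈ W.toSubmodule
  rw [P.coe_archRepLie_apply]
  have h := P.map_dπ_archRep G ιG (T := W.toSubmodule.starProjection) (P.starProjection_archRep G ιG W) w.2 X
  have hw' : W.toSubmodule.starProjection (w : P.space.toSubmodule) = (w : P.space.toSubmodule) :=
    Submodule.starProjection_eq_self_iff.mpr hw
  rw [hw'] at h
  rw [← h]
  exact W.toSubmodule.starProjection_apply_mem _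

variable [StarModule ℝ A] [ContinuousStar A]

-- the carrier `↥core` is a third-level subtype of `L²` (`L² ⊇ P ⊇ archModule ⊇ core`): instance synthesis on it needs head-room,
-- and the GK predicates must be given `(V := ↥core)` explicitly (else `AddCommGroup.toAddCommMonoid ?_ ≟ Submodule.addCommMonoid _` is not solved)
set_option synthInstance.maxHeartbeats 100000 in
/-- **The core with its restricted actions is a `(𝔤, K)`-module** (★ `GKSubmodule.isGKModule_sub` over ★ `isGKModule_archModule`).
[cite: KnappVogan1995, §I.3–I.4] [cite: BorelWallach2000, 0 §2.5–2.6] -/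
theorem isGKModule_core :
    IsGKModule (V := ↥(W.toSubmodule.comap (P.archModule G ιG).subtype)) G
      ((P.archRepK G ιG).subrepresentation (W.toSubmodule.comap (P.archModule G ιG).subtype) (core_le_comap_archRepK P G ιG W))
      (GKSubmodule.subLie G (P.archRepLie G ιG hι) (W.toSubmodule.comap (P.archModule G ιG).subtype)
        (core_le_comap_archRepLie P G ιG W hι)) :=
  GKSubmodule.isGKModule_sub G (P.archRepK G ιG) (P.archRepLie G ιG hι) (W.toSubmodule.comap (P.archModule G ιG).subtype)
    (core_le_comap_archRepK P G ιG W) (core_le_comap_archRepLie P G ιG W hι) (P.isGKModule_archModule G ιG hι)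

/-! ## §3 Detection INSIDE the core (★ B5a co-restricted) -/

set_option maxHeartbeats 400000 in
omit [StarModule ℝ A] [ContinuousStar A] in
/-- **Every non-zero smooth `K`-finite vector of `P|_G` is detected by a `(𝔤, K)`-map INTO THE CORE of `W`** (`W ≠ ⊥`; `G(𝔸_K) = ιG(G) · C`
with `C` centralising `ιG(G)`): the co-restriction of ★ B5a `F0P3TranslateDetection.exists_gkMap_ne_zero_of_closedSubrep` (the Harish-Chandra
map of `p_W ∘ P(c⁻¹)`, some `c ∈ C`, whose values lie in `W`). [cite: Dixmier1977, §13.1.2 and §13.1.8] [cite: BorelJacquetCorvallis1979, §4.6] -/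
theorem exists_gkMap_to_core_ne_zero {C : Subgroup 𝒢.Adelic}
    (hC : ∀ (u : G.carrier) (c : 𝒢.Adelic), c ∈ C → ιG u * c = c * ιG u)
    (hgen : ∀ g : 𝒢.Adelic, ∃ (u : G.carrier) (c : 𝒢.Adelic), c ∈ C ∧ g = ιG u * c)
    (hW : W ≠ ⊥) {v : P.archModule G ιG} (hv : v ≠ 0) :
    ∃ φ : P.archModule G ιG →ₗ[ℂ] ↥(W.toSubmodule.comap (P.archModule G ιG).subtype),
      (∀ (k : G.maximalCompact) (w : P.archModule G ιG),
        φ (P.archRepK G ιG k w) =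
          (P.archRepK G ιG).subrepresentation (W.toSubmodule.comap (P.archModule G ιG).subtype)
            (core_le_comap_archRepK P G ιG W) k (φ w)) ∧
      (∀ (X : G.lie) (w : P.archModule G ιG),
        φ (P.archRepLie G ιG hι X w) =
          GKSubmodule.subLie G (P.archRepLie G ιG hι) (W.toSubmodule.comap (P.archModule G ιG).subtype)
            (core_le_comap_archRepLie P G ιG W hι) X (φ w)) ∧
      φ v ≠ 0 := by
  obtain ⟨c, hc, φ, hφK, hφ𝔤, hφW, -, hφv⟩ :=
    F0P3TranslateDetection.exists_gkMap_ne_zero_of_closedSubrep P G ιG hι hC hgen W hW hv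
  refine ⟨LinearMap.codRestrict _ φ (fun w => hφW w), fun k w => Subtype.ext (hφK k w),
    fun X w => Subtype.ext (hφ𝔤 X w), fun h => hφv ?_⟩
  simpa using congrArg Subtype.val h

end Core

/-! ## §4 HEADS — the letter F1a `P.ArchIsotypy G ιG` BY NAME -/

section Heads

variable {K : Type} [Field K] [NumberField K] {𝒢 : AdelicGroupData.{0} K}
  {μ : Measure 𝒢.automorphicQuotient} [𝒢.IsAutomorphicMeasure μ]
  {A : Type*} [NormedCommRing A] [NormedAlgebra ℝ A] [NormedAlgebra ℚ A] [CompleteSpace A]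
  [StarRing A] {N : Type*} [Fintype N] [DecidableEq N]
  (P : DiscreteAutomorphicRep 𝒢 μ) (G : RealMatrixGroup A N) (ιG : G.carrier →* 𝒢.Adelic)
  [FiniteDimensional ℝ A] [StarModule ℝ A] [ContinuousStar A] (hι : Continuous ιG)

/-- **HEAD 1 — archimedean isotypy from a `(𝔤, K)`-map into an irreducible admissible module, injective on the core of one closed invariant
`W ≠ ⊥`.**  Given `ψ : P.archModule G ιG →ₗ[ℂ] M`, `K`- and `𝔤`-equivariant into an irreducible admissible `(𝔤, K)`-module
`(M, σK, σ𝔤)`, with `ψ w = 0 ⇒ w = 0` for the smooth `K`-finite `w ∈ W`: then `P.ArchIsotypy G ιG` — for every `v ≠ 0` the `(𝔤, K)`-map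
`ψ ∘ φ_v` (★ B5a) detects `v`.  The letter's `hfac` binder supplies the commuting complement `C`; nothing is assumed outside the letter's text
but `(W, M, ψ)`. [cite: FlathCorvallis1979, Thm. 3 and Thm. 4] [cite: BorelJacquetCorvallis1979, §4.3 and §4.6] [cite: Dixmier1977, §13.1.8] -/
theorem archIsotypy_of_gkMap_injOn_core (W : ContRepresentation.ClosedSubrep (P.archRep G ιG)) (hW : W ≠ ⊥)
    {M : Type} [AddCommGroup M] [Module ℂ M] (σK : Representation ℂ G.maximalCompact M) (σ𝔤 : G.lie →ₗ⁅ℝ⁆ Module.End ℂ M)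
    (hGK : IsGKModule G σK σ𝔤) (hirr : IsIrreducibleGK σK σ𝔤) (hadm : IsAdmissibleGK σK)
    (ψ : P.archModule G ιG →ₗ[ℂ] M)
    (hψK : ∀ (k : G.maximalCompact) (w : P.archModule G ιG), ψ (P.archRepK G ιG k w) = σK k (ψ w))
    (hψ𝔤 : ∀ (X : G.lie) (w : P.archModule G ιG), ψ (P.archRepLie G ιG hι X w) = σ𝔤 X (ψ w))
    (hψinj : ∀ w : P.archModule G ιG, (w : P.space.toSubmodule) ∈ W → ψ w = 0 → w = 0) :
    P.ArchIsotypy G ιG := by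
  intro _ _ _ _hA _hG hι' hfac
  obtain ⟨C, hC, hgen⟩ := hfac
  refine ⟨M, inferInstance, inferInstance, σK, σ𝔤, hGK, hirr, hadm, fun v hv => ?_⟩
  obtain ⟨c, hc, φ, hφK, hφ𝔤, hφW, -, hφv⟩ :=
    F0P3TranslateDetection.exists_gkMap_ne_zero_of_closedSubrep P G ιG hι hC hgen W hW hv
  refine ⟨ψ ∘ₗ φ, fun k w => ?_, fun X w => ?_, fun h => hφv (hψinj (φ v) (hφW v) h)⟩
  · rw [LinearMap.comp_apply, hφK, hψK, LinearMap.comp_apply]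
  · rw [LinearMap.comp_apply, hφ𝔤, hψ𝔤, LinearMap.comp_apply]

-- the carrier `↥core` is a third-level subtype of `L²` (`L² ⊇ P ⊇ archModule ⊇ core`): instance synthesis on it needs head-room,
-- and the GK predicates must be given `(V := ↥core)` explicitly (else `AddCommGroup.toAddCommMonoid ?_ ≟ Submodule.addCommMonoid _` is not solved)
set_option synthInstance.maxHeartbeats 100000 in
omit [StarModule ℝ A] [ContinuousStar A] in
/-- **HEAD 2 — archimedean isotypy from one closed invariant `W ≠ ⊥` whose Harish-Chandra core is irreducible admissible.**  If the
core `P.archModule G ιG ⊓ W` with its restricted actions (§2) is an irreducible (`IsIrreducibleGK`) admissible (`IsAdmissibleGK`)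
`(𝔤, K)`-module, then `P.ArchIsotypy G ιG`: `M :=` the core, separating maps from §3. [cite: FlathCorvallis1979, Thm. 3 and Thm. 4]
[cite: BorelJacquetCorvallis1979, §4.3 and §4.6] [cite: Dixmier1977, §13.1.8] -/
theorem archIsotypy_of_core (W : ContRepresentation.ClosedSubrep (P.archRep G ιG)) (hW : W ≠ ⊥)
    (hirr : IsIrreducibleGK (V := ↥(W.toSubmodule.comap (P.archModule G ιG).subtype))
      ((P.archRepK G ιG).subrepresentation (W.toSubmodule.comap (P.archModule G ιG).subtype) (core_le_comap_archRepK P G ιG W))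
      (GKSubmodule.subLie G (P.archRepLie G ιG hι) (W.toSubmodule.comap (P.archModule G ιG).subtype)
        (core_le_comap_archRepLie P G ιG W hι)))
    (hadm : IsAdmissibleGK (V := ↥(W.toSubmodule.comap (P.archModule G ιG).subtype))
      ((P.archRepK G ιG).subrepresentation (W.toSubmodule.comap (P.archModule G ιG).subtype) (core_le_comap_archRepK P G ιG W))) :
    P.ArchIsotypy G ιG := by
  intro _ _ _ _hA _hG hι' hfac
  obtain ⟨C, hC, hgen⟩ := hfac
  refine ⟨↥(W.toSubmodule.comap (P.archModule G ιG).subtype), Submodule.addCommGroup _, Submodule.module _,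
    (P.archRepK G ιG).subrepresentation (W.toSubmodule.comap (P.archModule G ιG).subtype) (core_le_comap_archRepK P G ιG W),
    GKSubmodule.subLie G (P.archRepLie G ιG hι) (W.toSubmodule.comap (P.archModule G ιG).subtype)
      (core_le_comap_archRepLie P G ιG W hι),
    isGKModule_core P G ιG W hι, hirr, hadm, fun v hv => ?_⟩
  obtain ⟨φ, hφK, hφ𝔤, hφv⟩ := exists_gkMap_to_core_ne_zero P G ιG W hι hC hgen hW hv
  exact ⟨φ, hφK, hφ𝔤, hφv⟩

-- the carrier `↥core` is a third-level subtype of `L²` (`L² ⊇ P ⊇ archModule ⊇ core`): instance synthesis on it needs head-room,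
-- and the GK predicates must be given `(V := ↥core)` explicitly (else `AddCommGroup.toAddCommMonoid ?_ ≟ Submodule.addCommMonoid _` is not solved)
set_option synthInstance.maxHeartbeats 100000 in
omit [StarModule ℝ A] [ContinuousStar A] in
/-- **HEAD 3 — the same with irreducibility in submodule language** (★ B1's currency): the core `W₀ := W.comap (archModule).subtype` is
`≠ ⊥`, every `(𝔤, K)`-submodule of `P.archModule G ιG` (for `P.archRepK`, `P.archRepLie`) contained in `W₀` is `⊥` or `W₀`, and the `K`-action
on `W₀` is admissible ⇒ `P.ArchIsotypy G ιG`.  (`W₀ ≠ ⊥` forces `W ≠ ⊥`.) [cite: FlathCorvallis1979, Thm. 3 and Thm. 4]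
[cite: BorelJacquetCorvallis1979, §4.3 and §4.6] [cite: KnappVogan1995, §II.4 (after Cor. 2.78)] -/
theorem archIsotypy_of_core' (W : ContRepresentation.ClosedSubrep (P.archRep G ιG))
    (hne : W.toSubmodule.comap (P.archModule G ιG).subtype ≠ ⊥)
    (hirr : ∀ U : Submodule ℂ (P.archModule G ιG), IsGKSubmodule (P.archRepK G ιG) (P.archRepLie G ιG hι) U →
      U ≤ W.toSubmodule.comap (P.archModule G ιG).subtype →
        U = ⊥ ∨ U = W.toSubmodule.comap (P.archModule G ιG).subtype)
    (hadm : IsAdmissibleGK (V := ↥(W.toSubmodule.comap (P.archModule G ιG).subtype))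
      ((P.archRepK G ιG).subrepresentation (W.toSubmodule.comap (P.archModule G ιG).subtype) (core_le_comap_archRepK P G ιG W))) :
    P.ArchIsotypy G ιG := by
  have hW : W ≠ ⊥ := by
    intro hbot
    apply hne
    rw [Submodule.eq_bot_iff]
    intro w hw
    have hw' : (w : P.space.toSubmodule) ∈ (W : ContRepresentation.ClosedSubrep (P.archRep G ιG)) := hw
    rw [hbot, ContRepresentation.ClosedSubrep.mem_bot] at hw'
    exact Subtype.ext hw'
  intro _ _ _ hA hG hι' hfac
  exact archIsotypy_of_core P G ιG hι W hW
    (isIrreducibleGK_sub_of_submodules (core_le_comap_archRepK P G ιG W) (core_le_comap_archRepLie P G ιG W hι) hne hirr) hadm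
    hA hG hι' hfac

end Heads

end Summit.HodgeConjecture.HodgeConjecture.Cruxes.H413.F0P3ArchIsotypyOfIrreducibleCore
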